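import Mathlib.RingTheory.PowerSeries.Inverse
import Mathlib.RingTheory.DiscreteValuationRing.Basic
import Mathlib.RingTheory.Ideal.Maps
import HarnessLib

/-!
# X11b, route R1 — "evaluating generators at `𝟙`": `Ch_Λ(X) Λ_{R₀} = (L_p(f)) ⟹ ord_p f_ac(0) = ord_p L_p(f)(𝟙)`

HONEST FRAMING (cell `b2b-bsdres`, run/shared/lean/b2b/bsd-rank1-residual/, verbatim in every
file): the goal of the cell is to DELETE the COMBINATION-SHAPED residual classes of the
Birch–Swinnerton-Dyer formula for ALL analytic-rank `≤ 1` elliptic curves over `ℚ` — "full BSD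
formula for every rank `≤ 1` curve in class `C`" assembled STRICTLY from published theorems — so
that the rank-`≤ 1` remainder becomes exactly the CONSTRUCTION-SHAPED classes, which are TYPED
(missing-input `Prop`s), NOT attempted. This is not "finishing BSD". Sub-cell
`b2b-bsdres-multr1-p1` (X11b via the re-proof of Castella 2018 Thm. A along the author's erratum):
a RESEARCH ROUTE; no claim beyond the stated class; X11b stays CONSTRUCTION-SHAPED; nothing here
changes a label. THEOREMS ONLY (Mathlib-only algebra; no definition, no named fact, no `sorry`).

## What this file kernel-checks

The glue between the two kernel pieces of route R1 that meet at the erratum's Thm. 1.1: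
* the ALGEBRA side (gens 3–4: `CongruenceLimit.isTorsion_and_charIdeal_eq_of_congruences`,
  `TorsionControl.isTorsion_and_charIdeal_eq_of_selmer_congruences`) concludes
  `char_Λ(X) = (L)` as an equality of ideals of `Λ = 𝒪⟦T⟧`;
* the VALUATION side (gen 1: `CastellaErratumLinks.lean`) consumes Thm. 1.1 through the shadow
  predicate `LambdaAdicShadow.IMCAtTrivialChar : ord_p f_ac(0) = ord_p L_p(f)(𝟙)`, whose docstring
  says "(erratum Thm. 1.1) gives, evaluating generators at `𝟙`, `ord_p f_ac(0) = ord_p L_p(f)(𝟙)`"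
  and pins `charValOrd = ord_p f_ac(0)` as "independent of the generator".
Both quoted phrases are proved here for power series over any discrete valuation ring `R₀`
(evaluation at the trivial character `𝟙` of `Γ` is `T ↦ 0`, i.e. `PowerSeries.constantCoeff`):
* `associated_constantCoeff_of_associated` / `_of_span_eq`: generators of the same principal ideal
  of `𝒪⟦T⟧` have associated constant terms (units of `𝒪⟦T⟧` have unit constant term);
* `addVal_constantCoeff_eq_of_span_eq`: **generator independence of `ord f(0)`** over `R₀⟦T⟧`;
* `addVal_constantCoeff_eq_of_map_eq_span`: **`C = (f_ac)` in `𝒪⟦T⟧` and `C·R₀⟦T⟧ = (L)` ⟹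
  `ord(ι f_ac(0)) = ord(L(0))`** in the valuation of `R₀` (the erratum's identity lives in
  `Λ_𝒪^{ur} ⊇ R₀⟦T⟧`, `R₀ = W(𝔽̄_p)` unramified over `ℤ_p`, so this valuation is `ord_p`);
  one-ring form `addVal_constantCoeff_eq_of_eq_span`.
Nothing arithmetic is asserted: the objects `X_ac`, `L_p(f)` remain shadow-typed; this file only
certifies that an ideal-theoretic Thm. 1.1 yields the valuation identity (IMC) of the §5 display,
for EVERY choice of generator. CONDITIONAL on nothing; deletes nothing; X11b stays
CONSTRUCTION-SHAPED.

References: F. Castella, Erratum, Thm. 1.1 and "the same argument as in [Cas18, §5]"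
[Castella2018Erratum]; F. Castella, Camb. J. Math. 6 (2018), Thm. 2.3 and §5 display (5.3)
[Castella2018].
-/

namespace Summit.BirchSwinnertonDyer.Rank1Residual.X11b.CongruenceLimit

open PowerSeries IsDiscreteValuationRing

/-! ### Constant terms of associated power series -/

/-- **Associated power series have associated constant terms** (units of `𝒪⟦T⟧` have unit constant
term, Mathlib `PowerSeries.isUnit_constantCoeff`). [folklore] -/
theorem associated_constantCoeff_of_associated {𝒪 : Type*} [CommRing 𝒪] {f g : PowerSeries 𝒪}
    (h : Associated f g) : Associated (constantCoeff f) (constantCoeff g) := by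
  obtain ⟨u, rfl⟩ := h
  refine ⟨(isUnit_constantCoeff (u : PowerSeries 𝒪) u.isUnit).unit, ?_⟩
  rw [IsUnit.unit_spec, map_mul]

/-- The same from an equality of principal ideals `(f) = (g)` of `𝒪⟦T⟧` (`𝒪` a domain). [folklore] -/
theorem associated_constantCoeff_of_span_eq {𝒪 : Type*} [CommRing 𝒪] [IsDomain 𝒪]
    {f g : PowerSeries 𝒪} (h : Ideal.span {f} = Ideal.span {g}) :
    Associated (constantCoeff f) (constantCoeff g) :=
  associated_constantCoeff_of_associated (Ideal.span_singleton_eq_span_singleton.1 h)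

/-- Associated elements of a discrete valuation ring have the same valuation. [folklore] -/
theorem addVal_eq_of_associated {R₀ : Type*} [CommRing R₀] [IsDomain R₀]
    [IsDiscreteValuationRing R₀] {a b : R₀} (h : Associated a b) : addVal R₀ a = addVal R₀ b := by
  obtain ⟨u, rfl⟩ := h
  rw [addVal_mul, addVal_eq_zero_of_unit, add_zero]

/-- **Generator independence of `ord f(0)`**: two generators of the same principal ideal of
`R₀⟦T⟧` (`R₀` a DVR) have constant terms of the same valuation — the fact behind the shadow field
`LambdaAdicShadow.charValOrd = ord_p f_ac(0)` "independent of the generator"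
(`CastellaErratumLinks.lean`). [folklore] -/
theorem addVal_constantCoeff_eq_of_span_eq {R₀ : Type*} [CommRing R₀] [IsDomain R₀]
    [IsDiscreteValuationRing R₀] {f g : PowerSeries R₀} (h : Ideal.span {f} = Ideal.span {g}) :
    addVal R₀ (constantCoeff f) = addVal R₀ (constantCoeff g) :=
  addVal_eq_of_associated (associated_constantCoeff_of_span_eq h)

/-! ### Base change `Λ_𝒪 → Λ_{R₀}` and the trivial-character evaluation -/

/-- Extension of scalars of a principal ideal along `𝒪⟦T⟧ → R₀⟦T⟧`:
`(f) Λ_{R₀} = (f^ι)`. [folklore] -/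
theorem map_span_singleton_powerSeries {𝒪 R₀ : Type*} [CommRing 𝒪] [CommRing R₀] (ι : 𝒪 →+* R₀)
    (f : PowerSeries 𝒪) :
    Ideal.map (PowerSeries.map ι) (Ideal.span {f}) = Ideal.span {PowerSeries.map ι f} := by
  rw [Ideal.map_span, Set.image_singleton]

/-- `constantCoeff` commutes with `PowerSeries.map`. [folklore] -/
theorem constantCoeff_map_apply {𝒪 R₀ : Type*} [CommRing 𝒪] [CommRing R₀] (ι : 𝒪 →+* R₀)
    (f : PowerSeries 𝒪) : constantCoeff (PowerSeries.map ι f) = ι (constantCoeff f) := by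
  rw [← coeff_zero_eq_constantCoeff_apply, coeff_map, coeff_zero_eq_constantCoeff_apply]

/-- **"Evaluating generators at `𝟙`"** (the sentence turning the erratum's Thm. 1.1,
`Ch_Λ(X_ac) Λ_{R₀} = (L_p(f))`, into the shadow link `IMCAtTrivialChar : ord_p f_ac(0) = ord_p L_p(f)(𝟙)`
of `CastellaErratumLinks.lean`): if an ideal `C` of `𝒪⟦T⟧` (`Ch_Λ(X)`) is principal with generator
`f_ac`, and its extension to `R₀⟦T⟧` along `ι : 𝒪 → R₀` (`R₀` a discrete valuation ring, e.g.
`W(𝔽̄_p)`, `ι` the structure map of `ℤ_p` or `𝒪`) is `(L)`, then `ord(ι f_ac(0)) = ord(L(0))` in the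
valuation of `R₀` (evaluation at the trivial character `𝟙 ↔ T = 0` is `constantCoeff`). For `R₀`
unramified over `ℤ_p` this valuation is `ord_p`. [cite: Castella2018Erratum, Thm. 1.1 (the identity in Λ_{R₀})] -/
theorem addVal_constantCoeff_eq_of_map_eq_span {𝒪 R₀ : Type*} [CommRing 𝒪] [CommRing R₀]
    [IsDomain R₀] [IsDiscreteValuationRing R₀] (ι : 𝒪 →+* R₀) {C : Ideal (PowerSeries 𝒪)}
    {f : PowerSeries 𝒪} (hC : C = Ideal.span {f}) {L : PowerSeries R₀}
    (hL : Ideal.map (PowerSeries.map ι) C = Ideal.span {L}) :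
    addVal R₀ (ι (constantCoeff f)) = addVal R₀ (constantCoeff L) := by
  rw [hC, map_span_singleton_powerSeries] at hL
  rw [← constantCoeff_map_apply]
  exact addVal_constantCoeff_eq_of_span_eq hL

/-- The same over one ring (`𝒪 = R₀`, `ι = id`): `Ch(X) = (f_ac)` and `Ch(X) = (L)` give
`ord f_ac(0) = ord L(0)`. [folklore] -/
theorem addVal_constantCoeff_eq_of_eq_span {R₀ : Type*} [CommRing R₀] [IsDomain R₀]
    [IsDiscreteValuationRing R₀] {C : Ideal (PowerSeries R₀)} {f L : PowerSeries R₀}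
    (hC : C = Ideal.span {f}) (hL : C = Ideal.span {L}) :
    addVal R₀ (constantCoeff f) = addVal R₀ (constantCoeff L) :=
  addVal_constantCoeff_eq_of_span_eq (hC.symm.trans hL)

end Summit.BirchSwinnertonDyer.Rank1Residual.X11b.CongruenceLimit
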